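/-
Literature/AlgebraicGeometry/Pohlmann1968/DegenerateCMTypesAbelianCMFieldHodgeClassCriterion.lean — pub-hodgecm2 (COR-CM), KEPT Literature
lane lit-deligne-3 gen 67, file F67d.  THEOREMS ONLY (no `def`, no named fact, no `sorry`, no instance, no notation; D-0026 net debt 0).
HC_CM is NOT proved.
-/
import Literature.AlgebraicGeometry.Pohlmann1968.MixedDifferenceCubeAbelianKernels
import Literature.AlgebraicGeometry.Pohlmann1968.MixedDifferenceCubeExponentFamilies
import Literature.AlgebraicGeometry.Pohlmann1968.DegenerateCMTypesAbelianCMFieldRankFormula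
import Literature.AlgebraicGeometry.Pohlmann1968.WeilTypeCMSubfieldRankBound
import HarnessLib

/-!
# Nondegeneracy of a CM type of an abelian CM field, read on Hodge classes: no cyclic CM subfield all of whose
# fibres (2-power degree) or coset cubes (degree with an odd prime factor) are Pohlmann-balanced

The lane's census (F66l `RankFormula.isNondegenerate_iff_forall_intermediateField_finrank`: Kubota's defect of an abelian CM field `K`
indexed by the cyclic CM subfields `F ⊆ K` and three kinds of conditions on `Φ|_F`) is restated with EVERY list read as a statement about
candidate Hodge classes on the abelian varieties of type `(K; Φ)` (Pohlmann's Theorem 1: a set `S ⊆ Hom(K, ℂ)` of `2m` embeddings spans a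
line of Hodge `(m,m)`-classes iff it is GALOIS-BALANCED, tree `IsGaloisBalanced`):

* lists (i) (imaginary quadratic `F`) and (ii) (cyclic CM `F` of degree `2^j`, `j ≥ 2`): "`Φ|_F` equidistributed" ⟺ EVERY FIBRE
  `Δ_τ = {φ : φ|_F = τ}` is Galois-balanced — the Weil classes of `(A, F)` (`WeilTypeCMSubfieldExceptionalClasses.isGaloisBalanced_fibre`
  and its converse `forall_isGaloisBalanced_fibre_iff`, `…_iff_two_mul` below);
* list (iii) (cyclic CM `F` of degree `2^j·d`, `1 ≠ d` odd): "mixed differences of the multiplicities of `Φ|_F` along the prime torsion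
  vanish" ⟺ EVERY COSET CUBE `S_F(σ, y)` along families of prime orders is Galois-balanced (F67b
  `MixedDifferenceCube.forall_alternatingSum_iff_forall_isGaloisBalanced`; Hazama's coset classes, White's sporadic sets).

Main statement **`isNondegenerate_iff_forall_intermediateField_isGaloisBalanced`**: `Φ` is nondegenerate iff NO cyclic CM subfield in the
three ranges has all its candidate sets Galois-balanced; contrapositive **`not_isNondegenerate_iff_exists_intermediateField_isGaloisBalanced`**:
a CM type of an abelian CM field is DEGENERATE iff some cyclic CM subfield `F` has ALL its fibres (when `[F:ℚ]` is a power of `2`) or ALL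
its coset cubes (otherwise) Galois-balanced — Lenstra's theorem (White 1993, Thm. 3: a degenerate abelian CM type carries sporadic
cycles on `A` itself; tree `DegenerateCMTypesAbelianFieldSporadicCycles`) with the cycles LOCATED by the census; §3 (gen 67 append) **`exists_located_exceptional_of_not_isNondegenerate`**: for a PRIMITIVE degenerate
type, on EVERY realisation `A`, the located fibre (over a non-real embedding) resp. EVERY located coset cube carries a rational `(m,m)`-class outside
`Dᵐ(A) ⊗ ℂ` (Weil classes: `WeilTypeCMSubfieldExceptionalClasses.exists_exceptional_of_fibres_balanced'`; cubes: F67c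
`exists_exceptional_of_forall_sum_char_eq_zero_of_index_two_pow_mul_primePowers`); §4 (gen 68 append)
**`exists_counted_exceptional_of_not_isNondegenerate`**: the same with the lines COUNTED — `dim Bᵐ(A) − dim Dᵐ(A) ≥ [F:ℚ]` in the Weil branch
(`WeilTypeCMSubfieldExceptionalClasses.finrank_le_finrank_sub_of_isTotallyComplex`) and `≥ [F:ℚ]·Π_{q ∣ d}(q−1)/2` in the cube branch
(F68b `MixedDifferenceCubeExponentFamilies.index_mul_prod_le_finrank_sub_of_forall_sum_char_eq_zero`).  Elementary glue; nothing on
algebraicity.  HC_CM is NOT proved and not used.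

## References

* [Kubota1965] T. Kubota, Trans. AMS 118 (1965), §4 Lemma 2.
* [White1993SporadicCycles] S. P. White, Compositio Math. 88 (1993), §4 Lemma 3, Thm. 3; §5 Prop. 1.
* [Hazama2003CyclicCM] F. Hazama, J. Math. Sci. Univ. Tokyo 10 (2003), Thm. 4.8, Remark 4.10, §5.
* [Gordon1999HodgeAVSurvey] B. B. Gordon, §9.2 (9.2.1), 9.2.2, 9.4.3; 5.13 (ii).
* [Pohlmann1968] H. Pohlmann, Ann. of Math. 88 (1968), Thm. 1.

## Provenance

Cell `pub-hodgecm2` (COR-CM), KEPT Literature lane `lit-deligne-3` gen 67 (claim ABELIAN-DEGENERATE-HODGE-CLASS-CRITERION; count-neutral), file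
F67d; neighbours cited by name, nothing restated: F66l `DegenerateCMTypesAbelianCMFieldRankFormula`, F67b `MixedDifferenceCubeAbelianKernels` (§1),
`WeilTypeCMSubfieldExceptionalClasses` (`isGaloisBalanced_fibre`), `WeilTypeCMSubfieldRankBound` (`card_fibre_eq_finrank`), `CMGaloisSubfield`.
-/

noncomputable section

open NumberField IntermediateField
open scoped IsMulCommutative

namespace Literature.AlgebraicGeometry.Pohlmann1968

namespace MixedDifferenceCube

open Literature.NumberTheory.ComplexMultiplication
open Literature.AlgebraicGeometry.Motives (AbelianVariety CMType)
open Literature.AlgebraicGeometry.HodgeTheory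
open Literature.AlgebraicGeometry.ComplexMultiplication (IsCMTypeRealisation)
open Literature.AlgebraicGeometry.VanGeemen1994 (hodgeClassSpan)
open Literature.Barriers.HodgeConjecture (divisorClassesSpan)
open CategoryTheory

open scoped Classical

/-! ## §1 Fibres: equidistribution over a subfield ⟺ every fibre is Galois-balanced -/

section Fibres

variable {K : Type} [Field K] [NumberField K] {k : Type} [Field k] (j : k →+* K) (Φ : CMType K)

/-- **Equidistribution ⟺ balanced fibres.**  `Φ` takes exactly half of every fibre `Δ_τ = {φ : φ ∘ j = τ}` iff every fibre is
Galois-balanced for `Φ` (`→`: `WeilTypeCMSubfieldExceptionalClasses.isGaloisBalanced_fibre`; `←`: the identity automorphism of `ℂ`).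
[cite: Gordon1999HodgeAVSurvey, §9.2 (9.2.1) and 5.13 (ii)] -/
theorem forall_isGaloisBalanced_fibre_iff :
    (∀ τ : k →+* ℂ, IsGaloisBalanced Φ (Finset.univ.filter fun φ : K →+* ℂ => φ.comp j = τ)) ↔
      ∀ τ : k →+* ℂ, {φ : K →+* ℂ | φ.comp j = τ ∧ φ ∈ Φ.1}.ncard = {φ : K →+* ℂ | φ.comp j = τ ∧ φ ∉ Φ.1}.ncard := by
  refine ⟨fun h τ => ?_, fun h τ => isGaloisBalanced_fibre j h τ⟩
  have h1 := h τ (RingEquiv.refl ℂ)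
  have hid : ∀ s : K →+* ℂ, ((RingEquiv.refl ℂ : ℂ ≃+* ℂ) : ℂ →+* ℂ).comp s = s := fun s => RingHom.ext fun _ => rfl
  simp only [Finset.mem_filter, Finset.mem_univ, true_and, hid] at h1
  exact h1

/-- The same with the equidistribution written `2·|Δ_τ ∩ Φ| = [K : k]` (`|Δ_τ| = [K : k]`, `WeilTypeCMSubfieldRankBound.card_fibre_eq_finrank`).
[cite: Gordon1999HodgeAVSurvey, §9.2 and 9.4.3] [cite: MilneFT2022, Prop. 2.7 (a)] -/
theorem forall_isGaloisBalanced_fibre_iff_two_mul [Algebra k K] :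
    (∀ τ : k →+* ℂ, IsGaloisBalanced Φ (Finset.univ.filter fun φ : K →+* ℂ => φ.comp (algebraMap k K) = τ)) ↔
      ∀ τ : k →+* ℂ, 2 * {φ : K →+* ℂ | φ.comp (algebraMap k K) = τ ∧ φ ∈ Φ.1}.ncard = Module.finrank k K := by
  rw [forall_isGaloisBalanced_fibre_iff]
  refine forall_congr' fun τ => ?_
  have hsplit : {φ : K →+* ℂ | φ.comp (algebraMap k K) = τ ∧ φ ∈ Φ.1}.ncard +
      {φ : K →+* ℂ | φ.comp (algebraMap k K) = τ ∧ φ ∉ Φ.1}.ncard = Module.finrank k K := by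
    rw [← card_fibre_eq_finrank (K := K) τ, ← Set.ncard_coe_finset]
    rw [← Set.ncard_union_eq (Set.disjoint_left.2 fun φ h1 h2 => h2.2 h1.2)]
    congr 1
    ext φ
    simp only [Set.mem_union, Set.mem_setOf_eq, Finset.coe_filter, Finset.mem_univ, true_and]
    tauto
  omega

end Fibres

/-! ## §2 The criterion -/

section Criterion

variable {K : Type} [Field K] [NumberField K] [IsCMField K] [IsAbelianGalois ℚ K]

/-- **NONDEGENERACY ⟺ NO CYCLIC CM SUBFIELD WITH ALL CANDIDATE CLASSES HODGE.**  For an abelian CM field `K` and any CM type `Φ`: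
`Φ` is nondegenerate (`Rank(Φ) = [K:ℚ]/2 + 1`) iff
(i) for no imaginary quadratic `F ⊆ K` are all fibres `Δ_τ` (`τ : F → ℂ`) Galois-balanced (no Weil structure over `F`);
(ii) for no cyclic CM subfield `F` of degree `2^j`, `2 ≤ j ≤ v₂([K:ℚ])`, are all fibres Galois-balanced;
(iii) for no cyclic CM subfield `F` of degree `2^j·d`, `1 ≤ j ≤ v₂([K:ℚ])`, `1 ≠ d ∣` the odd part of `[K:ℚ]`, are all coset cubes
`S_F(σ, y)` along the families `σ_q ∈ Gal(F/ℚ)` of prime orders `q ∣ d` Galois-balanced.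
(F66l's census with lists (i), (ii) read through §1 and list (iii) through F67b §1; F67c §4 `isNondegenerate_iff_forall_intermediateField_cubes`
is the partial reading converting list (iii) only.)
[cite: Kubota1965, §4 Lemma 2] [cite: Gordon1999HodgeAVSurvey, 9.4.3 and 5.13 (ii)] [cite: Hazama2003CyclicCM, Thm. 4.8, Remark 4.10]
[cite: White1993SporadicCycles, §4 Lemma 3 and Thm. 3] [cite: Pohlmann1968, Thm. 1] -/
theorem isNondegenerate_iff_forall_intermediateField_isGaloisBalanced (Φ : CMType K) :
    IsNondegenerate Φ ↔
      (∀ F : IntermediateField ℚ K, Module.finrank ℚ F = 2 → ¬ IsTotallyReal F →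
        ¬ ∀ τ : F →+* ℂ, IsGaloisBalanced Φ (Finset.univ.filter fun φ : K →+* ℂ => φ.comp (algebraMap F K) = τ)) ∧
      (∀ j ∈ Finset.Icc 2 ((Module.finrank ℚ K).factorization 2), ∀ F : IntermediateField ℚ K, Module.finrank ℚ F = 2 ^ j →
        ¬ IsTotallyReal F → IsCyclic (F ≃ₐ[ℚ] F) →
        ¬ ∀ τ : F →+* ℂ, IsGaloisBalanced Φ (Finset.univ.filter fun φ : K →+* ℂ => φ.comp (algebraMap F K) = τ)) ∧
      (∀ j ∈ Finset.Icc 1 ((Module.finrank ℚ K).factorization 2), ∀ d : ℕ, d ∣ ordCompl[2] (Module.finrank ℚ K) → d ≠ 1 →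
        ∀ F : IntermediateField ℚ K, Module.finrank ℚ F = 2 ^ j * d → ¬ IsTotallyReal F → IsCyclic (F ≃ₐ[ℚ] F) → ∀ [IsAbelianGalois ℚ F],
        ¬ ∀ σ : ↥d.primeFactors → (F ≃ₐ[ℚ] F), (∀ q, orderOf (σ q) = (q : ℕ)) → ∀ y : F →+* ℂ,
          IsGaloisBalanced Φ (Finset.univ.filter fun φ : K →+* ℂ => φ.comp (algebraMap F K) ∈
            Finset.univ.image fun ε : ↥d.primeFactors → Bool =>
              (if (∏ q, (if ε q then (-1 : ℤ) else 1)) = 1 then y else ComplexEmbedding.conjugate y).comp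
                (∏ q, (if ε q then σ q else 1)).toRingEquiv.toRingHom)) := by
  rw [RankFormula.isNondegenerate_iff_forall_intermediateField_finrank Φ]
  refine and_congr ?_ (and_congr ?_ ?_)
  · refine forall₃_congr fun F _ _ => not_congr ?_
    exact (forall_isGaloisBalanced_fibre_iff (algebraMap F K : F →+* K) Φ).symm
  · refine forall₂_congr fun j _ => forall₃_congr fun F _ _ => forall_congr' fun _ => not_congr ?_
    exact (forall_isGaloisBalanced_fibre_iff_two_mul (k := F) Φ).symm
  · refine forall₂_congr fun j _ => forall₂_congr fun d hd => forall_congr' fun hd1 => forall₂_congr fun F _ =>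
      forall₂_congr fun hF _ => forall_congr' fun _ => not_congr ?_
    haveI : NumberField F :=
      { to_charZero := inferInstance, to_finiteDimensional := inferInstance }
    have hd0 : d ≠ 0 := by
      rintro rfl
      have h0 : ordCompl[2] (Module.finrank ℚ K) = 0 := Nat.eq_zero_of_zero_dvd hd
      exact (Nat.ordCompl_pos 2 Module.finrank_pos.ne').ne' h0
    haveI : Nonempty ↥d.primeFactors := by
      obtain ⟨q, hq⟩ := Nat.nonempty_primeFactors.2 (lt_of_le_of_ne (Nat.one_le_iff_ne_zero.2 hd0) (Ne.symm hd1))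
      exact ⟨⟨q, hq⟩⟩
    have hodd2 : ¬ 2 ∣ d := fun h2 => (Nat.not_dvd_ordCompl Nat.prime_two Module.finrank_pos.ne') (h2.trans hd)
    have hc1 : conjGalRestrict F ≠ 1 := fun h => hF ((isTotallyReal_iff_conjGalRestrict_eq_one F).2 h)
    have hc : ∀ x : F →+* ℂ, x.comp (conjGalRestrict F : F →+* F) = ComplexEmbedding.conjugate x := fun x => by
      have h := isConj_conjGalRestrict F x
      unfold ComplexEmbedding.IsConj at h
      exact h.symm
    have key := forall_alternatingSum_iff_forall_isGaloisBalanced (algebraMap F K : F →+* K) (Φ := Φ) (ι := ↥d.primeFactors)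
      (p := fun q => (q : ℕ)) (fun q => Nat.prime_of_mem_primeFactors q.2) Subtype.val_injective
      (fun q h2 => hodd2 (h2 ▸ Nat.dvd_of_mem_primeFactors q.2)) (conjGalRestrict F) hc hc1
    -- `key` up to the (subsingleton) `Fintype` instance on `↥d.primeFactors → Bool`
    convert key using 10

/-- **A DEGENERATE CM TYPE OF AN ABELIAN CM FIELD HAS A CYCLIC CM SUBFIELD ALL OF WHOSE CANDIDATE SETS ARE HODGE CLASSES** (and
conversely): the contrapositive reading — `Φ` is degenerate iff SOME imaginary quadratic or cyclic `2`-power-degree CM subfield `F` has all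
its fibres Galois-balanced (Weil classes over `F` on every realisation), or SOME cyclic CM subfield `F` of degree `2^j·d` (`d ≠ 1` odd) and
SOME family of prime-order displacements have all coset cubes `S_F(σ, y)` Galois-balanced (Hazama ∕ White classes on every realisation).
This is Lenstra's theorem (White's Thm. 3) with the sporadic cycles located by the census; for a PRIMITIVE `Φ` the located classes lie
outside the divisor ring (`WeilTypeCMSubfieldExceptionalClasses.exists_exceptional_of_fibres_balanced`, F67b
`exists_exceptional_of_forall_sum_char_eq_zero…`). [cite: White1993SporadicCycles, §4 Thm. 3 and §5 Prop. 1]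
[cite: Hazama2003CyclicCM, Remark 4.10] [cite: Kubota1965, §4 Lemma 2] -/
theorem not_isNondegenerate_iff_exists_intermediateField_isGaloisBalanced (Φ : CMType K) :
    ¬ IsNondegenerate Φ ↔
      (∃ F : IntermediateField ℚ K, Module.finrank ℚ F = 2 ∧ ¬ IsTotallyReal F ∧
        ∀ τ : F →+* ℂ, IsGaloisBalanced Φ (Finset.univ.filter fun φ : K →+* ℂ => φ.comp (algebraMap F K) = τ)) ∨
      (∃ j ∈ Finset.Icc 2 ((Module.finrank ℚ K).factorization 2), ∃ F : IntermediateField ℚ K, Module.finrank ℚ F = 2 ^ j ∧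
        ¬ IsTotallyReal F ∧ IsCyclic (F ≃ₐ[ℚ] F) ∧
        ∀ τ : F →+* ℂ, IsGaloisBalanced Φ (Finset.univ.filter fun φ : K →+* ℂ => φ.comp (algebraMap F K) = τ)) ∨
      (∃ j ∈ Finset.Icc 1 ((Module.finrank ℚ K).factorization 2), ∃ d : ℕ, d ∣ ordCompl[2] (Module.finrank ℚ K) ∧ d ≠ 1 ∧
        ∃ F : IntermediateField ℚ K, Module.finrank ℚ F = 2 ^ j * d ∧ ¬ IsTotallyReal F ∧ IsCyclic (F ≃ₐ[ℚ] F) ∧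
        ∃ _ : IsAbelianGalois ℚ F, ∀ σ : ↥d.primeFactors → (F ≃ₐ[ℚ] F), (∀ q, orderOf (σ q) = (q : ℕ)) → ∀ y : F →+* ℂ,
          IsGaloisBalanced Φ (Finset.univ.filter fun φ : K →+* ℂ => φ.comp (algebraMap F K) ∈
            Finset.univ.image fun ε : ↥d.primeFactors → Bool =>
              (if (∏ q, (if ε q then (-1 : ℤ) else 1)) = 1 then y else ComplexEmbedding.conjugate y).comp
                (∏ q, (if ε q then σ q else 1)).toRingEquiv.toRingHom)) := by
  rw [isNondegenerate_iff_forall_intermediateField_isGaloisBalanced Φ, not_and_or, not_and_or]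
  refine or_congr ?_ (or_congr ?_ ?_)
  · simp only [not_forall, not_exists, not_not, exists_prop]
  · simp only [not_forall, not_exists, not_not, exists_prop]
  · simp only [not_forall, not_exists, not_not, not_and, exists_prop]

/-! ## §3 (gen 67 append) Lenstra's theorem, located: the exceptional classes of a degenerate primitive type -/

omit [IsCMField K] [IsAbelianGalois ℚ K] in
/-- A subfield that is not totally real has an embedding which is not real. [folklore] -/
private theorem exists_conjugate_ne (F : IntermediateField ℚ K) (hF : ¬ IsTotallyReal F) :
    ∃ τ₀ : F →+* ℂ, ComplexEmbedding.conjugate τ₀ ≠ τ₀ := by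
  by_contra h
  push Not at h
  exact hF ⟨fun v => InfinitePlace.isReal_iff.2 (ComplexEmbedding.isReal_iff.2 (h v.embedding))⟩

/-- **LENSTRA'S THEOREM WITH THE SPORADIC CYCLES LOCATED** (White 1993, Thm. 3: a degenerate simple abelian CM type carries sporadic cycles on `A`
itself; here the census says WHERE).  Let `K` be an abelian CM field, `Φ` a PRIMITIVE CM type which is DEGENERATE, and `(A, ι_A, θ)` any abelian
variety of type `(K; Φ)`.  Then EITHER (lists (i)/(ii)) there is a CM subfield `F` — imaginary quadratic, or cyclic of degree `2^j`, `j ≥ 2` — over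
which `Φ` is equidistributed, and then over every non-real embedding `τ₀` of `F` (there is one) the FIBRE `Δ_{τ₀}` (`|Δ_{τ₀}| = [K:F] = 2m`) carries a
rational `(m,m)`-class on `A` outside `Dᵐ(A) ⊗ ℂ` (a Weil class of `(A, F)`); OR (list (iii)) there is a cyclic CM subfield `F` of degree `2^j·d`,
`1 ≠ d` odd, such that for EVERY family `σ_q ∈ Gal(F/ℚ)` of prime orders `q ∣ d` (such families exist by Cauchy's theorem) and EVERY embedding `y`
of `F` the COSET CUBE `S_F(σ, y)` carries, for some `m` (`2m = |S_F(σ, y)| = 2^{ω(d)}[K:F]`), a rational `(m,m)`-class on `A` outside `Dᵐ(A) ⊗ ℂ`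
(a Hazama ∕ White class).  Glue of `not_isNondegenerate_iff_exists_intermediateField_isGaloisBalanced` with
`WeilTypeCMSubfieldExceptionalClasses.exists_exceptional_of_fibres_balanced'` and F67c `exists_exceptional_of_forall_sum_char_eq_zero_of_index_two_pow_mul_primePowers`.
[cite: White1993SporadicCycles, §4 Thm. 3 and §5 Prop. 1] [cite: Hazama2003CyclicCM, Thm. 4.8 (iv)–(vi), §5, Remark 4.10]
[cite: Gordon1999HodgeAVSurvey, 5.13 (ii), 9.2.2, 9.4.3] [cite: Kubota1965, §4 Lemma 2] [cite: Pohlmann1968, Thm. 1] -/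
theorem exists_located_exceptional_of_not_isNondegenerate (Φ : CMType K) {φ₀ : K →+* ℂ}
    (hprim : IsPrimitive (ℂ ≃+* ℂ) Φ.1 φ₀) (hdeg : ¬ IsNondegenerate Φ)
    {A : AbelianVariety ℂ} {ιA : 𝓞 K →+* End A} {θ : K →+* Module.End ℂ (complexBetti A.X 1)}
    (hA : IsCMTypeRealisation Φ A ιA θ) :
    (∃ F : IntermediateField ℚ K, ¬ IsTotallyReal F ∧
        (Module.finrank ℚ F = 2 ∨
          (IsCyclic (F ≃ₐ[ℚ] F) ∧ ∃ j ∈ Finset.Icc 2 ((Module.finrank ℚ K).factorization 2), Module.finrank ℚ F = 2 ^ j)) ∧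
        (∀ τ : F →+* ℂ, IsGaloisBalanced Φ (Finset.univ.filter fun φ : K →+* ℂ => φ.comp (algebraMap F K) = τ)) ∧
        (∃ τ₀ : F →+* ℂ, ComplexEmbedding.conjugate τ₀ ≠ τ₀) ∧
        ∀ τ₀ : F →+* ℂ, ComplexEmbedding.conjugate τ₀ ≠ τ₀ →
          ∃ m : ℕ, (Finset.univ.filter fun φ : K →+* ℂ => φ.comp (algebraMap F K) = τ₀).card = 2 * m ∧
            ∃ c : complexBetti A.X (2 * m), IsRationalClass c ∧
              IsOfHodgeType (Module.finrank ℚ K / 2) A.X (2 * m) m m c ∧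
              c ∉ divisorClassesSpan A.X (Module.finrank ℚ K / 2) m) ∨
    (∃ j ∈ Finset.Icc 1 ((Module.finrank ℚ K).factorization 2), ∃ d : ℕ, d ∣ ordCompl[2] (Module.finrank ℚ K) ∧ d ≠ 1 ∧
      ∃ F : IntermediateField ℚ K, Module.finrank ℚ F = 2 ^ j * d ∧ ¬ IsTotallyReal F ∧ IsCyclic (F ≃ₐ[ℚ] F) ∧
      ∃ _ : IsAbelianGalois ℚ F, ∀ σ : ↥d.primeFactors → (F ≃ₐ[ℚ] F), (∀ q, orderOf (σ q) = (q : ℕ)) → ∀ y : F →+* ℂ,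
        IsGaloisBalanced Φ (Finset.univ.filter fun φ : K →+* ℂ => φ.comp (algebraMap F K) ∈
            Finset.univ.image fun ε : ↥d.primeFactors → Bool =>
              (if (∏ q, (if ε q then (-1 : ℤ) else 1)) = 1 then y else ComplexEmbedding.conjugate y).comp
                (∏ q, (if ε q then σ q else 1)).toRingEquiv.toRingHom) ∧
        ∃ m : ℕ, ∃ c : complexBetti A.X (2 * m), IsRationalClass c ∧
          IsOfHodgeType (Module.finrank ℚ K / 2) A.X (2 * m) m m c ∧
          c ∉ divisorClassesSpan A.X (Module.finrank ℚ K / 2) m) := by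
  rcases (not_isNondegenerate_iff_exists_intermediateField_isGaloisBalanced Φ).1 hdeg with
    ⟨F, h2, hF, hbal⟩ | ⟨j, hj, F, hFj, hF, hcyc, hbal⟩ | ⟨j, hj, d, hd, hd1, F, hFj, hF, hcyc, hab, hbal⟩
  · refine Or.inl ⟨F, hF, Or.inl h2, hbal, exists_conjugate_ne F hF, fun τ₀ hτ₀ => ?_⟩
    exact exists_exceptional_of_fibres_balanced' (algebraMap F K : F →+* K) φ₀ hprim
      ((forall_isGaloisBalanced_fibre_iff (algebraMap F K : F →+* K) Φ).1 hbal) hτ₀ hA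
  · refine Or.inl ⟨F, hF, Or.inr ⟨hcyc, j, hj, hFj⟩, hbal, exists_conjugate_ne F hF, fun τ₀ hτ₀ => ?_⟩
    exact exists_exceptional_of_fibres_balanced' (algebraMap F K : F →+* K) φ₀ hprim
      ((forall_isGaloisBalanced_fibre_iff (algebraMap F K : F →+* K) Φ).1 hbal) hτ₀ hA
  · haveI : IsAbelianGalois ℚ F := hab
    refine Or.inr ⟨j, hj, d, hd, hd1, F, hFj, hF, hcyc, hab, fun σ hσ y => ⟨hbal σ hσ y, ?_⟩⟩
    haveI : NumberField F :=
      { to_charZero := inferInstance, to_finiteDimensional := inferInstance }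
    have hd0 : d ≠ 0 := by
      rintro rfl
      have h0 : ordCompl[2] (Module.finrank ℚ K) = 0 := Nat.eq_zero_of_zero_dvd hd
      exact (Nat.ordCompl_pos 2 Module.finrank_pos.ne').ne' h0
    haveI : Nonempty ↥d.primeFactors := by
      obtain ⟨q, hq⟩ := Nat.nonempty_primeFactors.2 (lt_of_le_of_ne (Nat.one_le_iff_ne_zero.2 hd0) (Ne.symm hd1))
      exact ⟨⟨q, hq⟩⟩
    have hodd2 : ¬ 2 ∣ d := fun h2 => (Nat.not_dvd_ordCompl Nat.prime_two Module.finrank_pos.ne') (h2.trans hd)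
    have hp : ∀ q : ↥d.primeFactors, ((q : ℕ)).Prime := fun q => Nat.prime_of_mem_primeFactors q.2
    have hodd : ∀ q : ↥d.primeFactors, (q : ℕ) ≠ 2 := fun q h2 => hodd2 (h2 ▸ Nat.dvd_of_mem_primeFactors q.2)
    -- the index of `Gal(K/F)`: `[F:ℚ] = 2^j · d = 2^{(j-1)+1} · Π_q q^{v_q(d)}`
    have hj1 : 1 ≤ j := (Finset.mem_Icc.1 hj).1
    have hprod : ∏ q ∈ d.primeFactors, q ^ d.factorization q = d := by
      rw [← Nat.prod_factorization_eq_prod_primeFactors (fun q m => q ^ m)]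
      exact Nat.prod_factorization_pow_eq_self hd0
    have hidx : F.fixingSubgroup.index =
        2 ^ ((j - 1) + 1) * ∏ q : ↥d.primeFactors, (q : ℕ) ^ ((d.factorization q - 1) + 1) := by
      rw [CMNumbers.index_fixingSubgroup_eq_finrank F, hFj, Nat.sub_add_cancel hj1,
        Finset.prod_coe_sort d.primeFactors (fun q : ℕ => q ^ ((d.factorization q - 1) + 1))]
      congr 1
      conv_lhs => rw [← hprod]
      refine Finset.prod_congr rfl fun q hq => ?_
      rw [Nat.sub_add_cancel (Nat.one_le_iff_ne_zero.2
        ((Nat.prime_of_mem_primeFactors hq).factorization_pos_of_dvd hd0 (Nat.dvd_of_mem_primeFactors hq)).ne')]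
    have hcyc' : IsCyclic ((K ≃ₐ[ℚ] K) ⧸ F.fixingSubgroup) := (AbelianKernels.isCyclic_quotient_fixingSubgroup_iff F).2 hcyc
    have hker := (forall_sum_char_eq_zero_iff_forall_isGaloisBalanced_of_index_two_pow_mul_primePowers φ₀ Φ F hF (j - 1)
      hp Subtype.val_injective hodd hidx hcyc').2 (by convert hbal using 10)
    obtain ⟨m, -, cl, hrat, hhodge, hnot⟩ :=
      exists_exceptional_of_forall_sum_char_eq_zero_of_index_two_pow_mul_primePowers φ₀ Φ F hF (j - 1) hp
        Subtype.val_injective hodd hidx hcyc' hker hprim σ hσ y hA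
    exact ⟨m, cl, hrat, hhodge, hnot⟩

/-! ## §4 (gen 68 append) Lenstra's theorem COUNTED: how many independent exceptional lines the located subfield gives -/

/-- **LENSTRA ∕ WHITE THM. 3 WITH THE SPORADIC CYCLES LOCATED AND COUNTED.**  `K` an abelian CM field, `Φ` a PRIMITIVE and DEGENERATE CM type,
`(A, ι_A, θ)` ANY realisation of `(K; Φ)`.  Then EITHER there is an imaginary quadratic or cyclic `2^j`-degree (`2 ≤ j ≤ v₂[K:ℚ]`) CM subfield
`F` over which `Φ` is equidistributed (all fibres Galois-balanced), and then in degree `2m = [K:F]`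
**`dim Bᵐ(A) − dim Dᵐ(A) ≥ [F:ℚ]`** — the `[F:ℚ]` fibres are distinct Weil lines outside the divisor ring (`F` has no real place;
`WeilTypeCMSubfieldExceptionalClasses.finrank_le_finrank_sub_of_isTotallyComplex`); OR there is a cyclic CM subfield `F` of degree `2^j·d`
(`1 ≤ j`, `1 ≠ d` odd) all of whose coset cubes are Galois-balanced, and then for EVERY family of generators `σ_q` (`orderOf σ_q = q`, `q ∣ d`
prime), in degree `2m = 2^{ω(d)}[K:F]`: **`dim Bᵐ(A) − dim Dᵐ(A) ≥ [F:ℚ] · Π_{q ∣ d} (q − 1)/2`** — base embeddings times sign-normalised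
exponent families give pairwise distinct cubes (`MixedDifferenceCubeExponentFamilies`; Hazama's `q(q−1)` for `[F:ℚ] = 2q`, `d = q`).
[cite: White1993SporadicCycles, §4 Thm. 3 and Lemma 3] [cite: Hazama2003CyclicCM, Prop. 3.2, Thm. 4.8 (iv)–(vi), §5, Remark 4.10]
[cite: Gordon1999HodgeAVSurvey, 9.2.2 and 5.13 (ii)] [cite: Kubota1965, §4 Lemma 2] [cite: Pohlmann1968, Thm. 1] -/
theorem exists_counted_exceptional_of_not_isNondegenerate (Φ : CMType K) {φ₀ : K →+* ℂ}
    (hprim : IsPrimitive (ℂ ≃+* ℂ) Φ.1 φ₀) (hdeg : ¬ IsNondegenerate Φ)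
    {A : AbelianVariety ℂ} {ιA : 𝓞 K →+* End A} {θ : K →+* Module.End ℂ (complexBetti A.X 1)}
    (hA : IsCMTypeRealisation Φ A ιA θ) :
    (∃ F : IntermediateField ℚ K, ¬ IsTotallyReal F ∧
        (Module.finrank ℚ F = 2 ∨
          (IsCyclic (F ≃ₐ[ℚ] F) ∧ ∃ j ∈ Finset.Icc 2 ((Module.finrank ℚ K).factorization 2), Module.finrank ℚ F = 2 ^ j)) ∧
        (∀ τ : F →+* ℂ, IsGaloisBalanced Φ (Finset.univ.filter fun φ : K →+* ℂ => φ.comp (algebraMap F K) = τ)) ∧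
        Module.finrank ℚ F ≤
          Module.finrank ℂ ↥(hodgeClassSpan (Module.finrank ℚ K / 2) A.X (Module.finrank F K / 2)) -
            Module.finrank ℂ ↥(divisorClassesSpan A.X (Module.finrank ℚ K / 2) (Module.finrank F K / 2))) ∨
    (∃ j ∈ Finset.Icc 1 ((Module.finrank ℚ K).factorization 2), ∃ d : ℕ, d ∣ ordCompl[2] (Module.finrank ℚ K) ∧ d ≠ 1 ∧
      ∃ F : IntermediateField ℚ K, Module.finrank ℚ F = 2 ^ j * d ∧ ¬ IsTotallyReal F ∧ IsCyclic (F ≃ₐ[ℚ] F) ∧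
      ∃ _ : IsAbelianGalois ℚ F,
        (∀ σ : ↥d.primeFactors → (F ≃ₐ[ℚ] F), (∀ q, orderOf (σ q) = (q : ℕ)) → ∀ y₀ : F →+* ℂ,
          IsGaloisBalanced Φ (Finset.univ.filter fun φ : K →+* ℂ => φ.comp (algebraMap F K) ∈
            Finset.univ.image fun ε : ↥d.primeFactors → Bool =>
              (if (∏ q, (if ε q then (-1 : ℤ) else 1)) = 1 then y₀ else ComplexEmbedding.conjugate y₀).comp
                (∏ q, (if ε q then σ q else 1)).toRingEquiv.toRingHom)) ∧
        Module.finrank ℚ F * ∏ q ∈ d.primeFactors, (q / 2) ≤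
          Module.finrank ℂ ↥(hodgeClassSpan (Module.finrank ℚ K / 2) A.X (2 ^ (d.primeFactors.card - 1) * Module.finrank F K)) -
            Module.finrank ℂ ↥(divisorClassesSpan A.X (Module.finrank ℚ K / 2)
              (2 ^ (d.primeFactors.card - 1) * Module.finrank F K))) := by
  -- the Weil-type branches: `F` is totally complex, so all `[F:ℚ]` fibres count, in degree `2m = [K:F]`
  have weil : ∀ F : IntermediateField ℚ K, ¬ IsTotallyReal F →
      (∀ τ : F →+* ℂ, IsGaloisBalanced Φ (Finset.univ.filter fun φ : K →+* ℂ => φ.comp (algebraMap F K) = τ)) →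
      Module.finrank ℚ F ≤
        Module.finrank ℂ ↥(hodgeClassSpan (Module.finrank ℚ K / 2) A.X (Module.finrank F K / 2)) -
          Module.finrank ℂ ↥(divisorClassesSpan A.X (Module.finrank ℚ K / 2) (Module.finrank F K / 2)) := by
    intro F hF hbal
    haveI : NumberField F :=
      { to_charZero := inferInstance, to_finiteDimensional := inferInstance }
    haveI : IsTotallyComplex F := isTotallyComplex_of_conjGalRestrict_ne_one F
      fun h => hF ((isTotallyReal_iff_conjGalRestrict_eq_one F).2 h)
    obtain ⟨τ₀⟩ : Nonempty (F →+* ℂ) := inferInstance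
    have h := finrank_le_finrank_sub_of_isTotallyComplex (algebraMap F K : F →+* K) φ₀ hprim
      ((forall_isGaloisBalanced_fibre_iff (algebraMap F K : F →+* K) Φ).1 hbal) τ₀ hA
    have h2 := (forall_isGaloisBalanced_fibre_iff_two_mul (K := K) (k := F) Φ).1 hbal τ₀
    have hm : {φ : K →+* ℂ | φ.comp (algebraMap F K) = τ₀ ∧ φ ∈ Φ.1}.ncard = Module.finrank F K / 2 := by omega
    rwa [hm] at h
  rcases (not_isNondegenerate_iff_exists_intermediateField_isGaloisBalanced Φ).1 hdeg with
    ⟨F, h2, hF, hbal⟩ | ⟨j, hj, F, hFj, hF, hcyc, hbal⟩ | ⟨j, hj, d, hd, hd1, F, hFj, hF, hcyc, hab, hbal⟩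
  · exact Or.inl ⟨F, hF, Or.inl h2, hbal, weil F hF hbal⟩
  · exact Or.inl ⟨F, hF, Or.inr ⟨hcyc, j, hj, hFj⟩, hbal, weil F hF hbal⟩
  · haveI : IsAbelianGalois ℚ F := hab
    refine Or.inr ⟨j, hj, d, hd, hd1, F, hFj, hF, hcyc, hab, hbal, ?_⟩
    haveI : NumberField F :=
      { to_charZero := inferInstance, to_finiteDimensional := inferInstance }
    have hd0 : d ≠ 0 := by
      rintro rfl
      have h0 : ordCompl[2] (Module.finrank ℚ K) = 0 := Nat.eq_zero_of_zero_dvd hd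
      exact (Nat.ordCompl_pos 2 Module.finrank_pos.ne').ne' h0
    obtain ⟨q₀, hq₀⟩ := Nat.nonempty_primeFactors.2 (lt_of_le_of_ne (Nat.one_le_iff_ne_zero.2 hd0) (Ne.symm hd1))
    haveI : Nonempty ↥d.primeFactors := ⟨⟨q₀, hq₀⟩⟩
    have hodd2 : ¬ 2 ∣ d := fun h2 => (Nat.not_dvd_ordCompl Nat.prime_two Module.finrank_pos.ne') (h2.trans hd)
    have hp : ∀ q : ↥d.primeFactors, ((q : ℕ)).Prime := fun q => Nat.prime_of_mem_primeFactors q.2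
    have hodd : ∀ q : ↥d.primeFactors, (q : ℕ) ≠ 2 := fun q h2 => hodd2 (h2 ▸ Nat.dvd_of_mem_primeFactors q.2)
    have hj1 : 1 ≤ j := (Finset.mem_Icc.1 hj).1
    have hprod : ∏ q ∈ d.primeFactors, q ^ d.factorization q = d := by
      rw [← Nat.prod_factorization_eq_prod_primeFactors (fun q m => q ^ m)]
      exact Nat.prod_factorization_pow_eq_self hd0
    have hidx : F.fixingSubgroup.index =
        2 ^ ((j - 1) + 1) * ∏ q : ↥d.primeFactors, (q : ℕ) ^ ((d.factorization q - 1) + 1) := by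
      rw [CMNumbers.index_fixingSubgroup_eq_finrank F, hFj, Nat.sub_add_cancel hj1,
        Finset.prod_coe_sort d.primeFactors (fun q : ℕ => q ^ ((d.factorization q - 1) + 1))]
      congr 1
      conv_lhs => rw [← hprod]
      refine Finset.prod_congr rfl fun q hq => ?_
      rw [Nat.sub_add_cancel (Nat.one_le_iff_ne_zero.2
        ((Nat.prime_of_mem_primeFactors hq).factorization_pos_of_dvd hd0 (Nat.dvd_of_mem_primeFactors hq)).ne')]
    have hcyc' : IsCyclic ((K ≃ₐ[ℚ] K) ⧸ F.fixingSubgroup) := (AbelianKernels.isCyclic_quotient_fixingSubgroup_iff F).2 hcyc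
    have hker := (forall_sum_char_eq_zero_iff_forall_isGaloisBalanced_of_index_two_pow_mul_primePowers φ₀ Φ F hF (j - 1)
      hp Subtype.val_injective hodd hidx hcyc').2 (by convert hbal using 10)
    -- a family of generators exists (Cauchy), so the count theorem applies
    have hcardF : Nat.card (F ≃ₐ[ℚ] F) = 2 ^ j * d := by rw [← hFj, IsGalois.card_aut_eq_finrank]
    have hσex : ∀ q : ↥d.primeFactors, ∃ g : F ≃ₐ[ℚ] F, orderOf g = (q : ℕ) := fun q => by
      haveI : Fact ((q : ℕ)).Prime := ⟨hp q⟩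
      exact exists_prime_orderOf_dvd_card' (q : ℕ)
        (by rw [hcardF]; exact dvd_mul_of_dvd_right (Nat.dvd_of_mem_primeFactors q.2) _)
    choose σ hσ using hσex
    have hcount := index_mul_prod_le_finrank_sub_of_forall_sum_char_eq_zero_finrank φ₀ Φ F hF (j - 1) hp Subtype.val_injective
      hodd hidx hcyc' hker hprim σ hσ hA
    have hdegF : 2 ^ ((j - 1) + 1) * ∏ q : ↥d.primeFactors, (q : ℕ) ^ ((d.factorization q - 1) + 1) = Module.finrank ℚ F :=
      hidx.symm.trans (CMNumbers.index_fixingSubgroup_eq_finrank F)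
    rw [hdegF, Fintype.card_coe, Finset.prod_coe_sort d.primeFactors (fun q : ℕ => q / 2)] at hcount
    exact hcount

end Criterion

end MixedDifferenceCube

end Literature.AlgebraicGeometry.Pohlmann1968
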